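import Summits.QuantumFields.YangMills.Theorems.BalabanUVNodesN15KingModelGraphPowerCountingSubgraphsCensus

/-!
# BalabanUVNodes ∕ N15 — THE KING-MODEL RUNG (PART Δ-d): **KING 1986 PROPOSITION 3.6 (3.56) WITH NO POSITIVITY HYPOTHESIS FOR SPARSE GRAPHS OF `G`-LINES** —
# for connected graphs whose lines are all `G`-propagators and whose every non-empty connected sub-line-set `S` is SPARSE, `(d−1)·|S| < (d+1)·(|V(S)| − 1)`,
# King's subgraph condition is decided by counting, so (3.56) holds outright (parts Γ∕Δ by name); the named class of connected PSEUDOFORESTS (no tadpole, no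
# parallel pair, `|S| ≤ |V(S)|` — loops allowed) in `1 ≤ d ≤ 3`, and the TRIANGLE: the first graphs with a loop for which (3.56) is a theorem with no hypothesis
# (Track A, DAG node N15 = NE2; FAN-OUT v1.1 §N15 s3 «KING-MODEL RUNG … NE2's analogue DECIDED in the model»)

HONEST FRAMING.  Count-neutral (cell `pub-ymgap`, seat `pub-ymgap-dag-n15-e` g28; `--supports stmt-QuantumFields-27366 --as helper` = K3⁸
`SpineGivenEndpointR13SepCoPHV`).  TEMPLATE LITERATURE: C. King, *The U(1) Higgs model. I. The continuum limit*, Commun. Math. Phys. **102** (1986) 649–677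
[King1986], Proposition 3.6 (3.56) p. 662, §3.4 p. 664.  Part Δ-b ★★★ `king_prop36_graph_zeroField_subgraphs` gives (3.56) for connected graphs under King's
ordering-free sentence «every subgraph has positive degree» (`PosSubgraphsBy src tgt 0 (d+1) (lineExp ∘ κ)`); part Δ-c decided that condition for pseudoforests
of `G`-lines.  THIS FILE puts the two together: for `G`-lines (`e ≡ 2 − (d+1)`) the degree of `S` is `(d+1)(|V(S)| − 1) − (d−1)|S|`, so SPARSITY of every
non-empty connected sub-line-set IS the subgraph condition, and Prop. 3.6 follows with no hypothesis on degrees, orderings, margins or certificates — for the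
sparse class, for connected pseudoforests in `1 ≤ d ≤ 3`, and for the triangle.  King's U(1)∕`A = 0` MODEL (odd `L ≥ 3`, constants per `(a, m₀², L)`); NOT
Bałaban's non-abelian `G(U)` of [B9]; NOT a node discharge; nothing continuum ∕ ℝ⁴ ∕ OS ∕ mass-gap ∕ Clay.  0 `sorry`; standard axioms.
THE PRINT.  p. 662 [PDF 14], Proposition 3.6 (3.56); p. 664 [PDF 16]: *«In order that this procedure work, it is necessary that every subgraph have positive degree
D … renormalised graphs, in which every subgraph has positive degree. We will assume below that this has been done already»*.
WHAT THIS FILE PROVES.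
* §1 (ns `…Graph`): `posSubgraphsBy_const_iff` (constant exponents `c`: the condition reads `γ₁ < dV(|V(S)| − 1) + c|S|`), ★ `posSubgraphsBy_GLines_of_sparse`
  (sparsity ⇒ the condition at margin `0` for `e ≡ 2 − dV`), `lConn_triangle` (the triangle is connected to its external vertex).
* §2 (ns `…Curved`) ★★★ **`king_prop36_graph_zeroField_sparse`** — (3.56) for CONNECTED graphs of `G`-lines all of whose non-empty connected sub-line-sets are sparse,
  `((d+1) − 2)·|S| < (d+1)·(|V(S)| − 1)`: NO positivity hypothesis; constants `(C₁, C₂, γ₀)` of part Γ-i, rate `L^{−min(γ₀,¼)K}`, orderings constant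
  `m!·((1 − L^{−¼})^{−1})^m`.
* §3 ★★★ **`king_prop36_graph_zeroField_pseudoforest`** — the same for every connected graph of `G`-lines with no tadpole, no parallel pair and `|S| ≤ |V(S)|` for
  every line set (each component of each sub-line-set carries at most one loop), in dimensions `1 ≤ d ≤ 3` (`2 ≤ d+1 ≤ 4`).
* §4 ★★ **`king_prop36_graph_zeroField_triangle`** — the triangle `{0,1}, {0,2}, {1,2}` of three `G`-lines (part Γ-j's example), `1 ≤ d ≤ 3`: (3.56) outright.
HONEST SCOPE.  (a) `G`-lines only (`κ ≡ none`); graphs with `∂G` lines or denser loops need King's §3.5 renormalisation ([Ba3], NOT typed) — parts Δ-b∕Δ-c∕Ε state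
exactly what it must deliver.  (b) As parts Γ: abstract one-vertex factors, root factor in `L¹`, (3.56)'s external tree decay not displayed.  (c) King's U(1)∕`A = 0`
model; his dimensions are `d+1 ∈ {3, 4}` here `d ∈ {2, 3}` (and `d = 1`); NOT Bałaban's `G(U)`; NE2∕N15 of record untouched; counts unmoved.  Locators: [King1986]
Prop. 3.6 (3.56) p.662, p.664, (3.77) p.666.
-/
noncomputable section

namespace Summit.QuantumFields.YangMills.BalabanUVNodes.N15KingModelRung.Graph

open scoped BigOperators
open Finset
open Summit.QuantumFields.YangMills.BalabanUVNodes.N15KingModelRung.Curved (triSrc triTgt)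

/-! ## §1 Sparsity is the subgraph condition for constant exponents -/

section Sparse
variable {nn m : ℕ} {src tgt : Fin m → Fin (nn + 1)}

/-- for constant exponents `c` King's subgraph condition reads `γ₁ < dV·(|V(S)| − 1) + c·|S|` for every non-empty connected `S`. [cite: King1986, p.664] -/
theorem posSubgraphsBy_const_iff (γ₁ dV c : ℝ) :
    PosSubgraphsBy src tgt γ₁ dV (fun _ => c)
      ↔ ∀ S : Finset (Fin m), S.Nonempty → (∀ u ∈ lineVerts src tgt S, ∀ v ∈ lineVerts src tgt S, LConn src tgt S u v) →
          γ₁ < dV * (((lineVerts src tgt S).card : ℝ) - 1) + c * S.card := by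
  unfold PosSubgraphsBy
  refine forall_congr' fun S => forall_congr' fun _ => forall_congr' fun _ => ?_
  rw [subDeg_const]

/-- ★ **SPARSITY GIVES THE SUBGRAPH CONDITION FOR `G`-LINES**: if every non-empty connected sub-line-set satisfies `(dV − 2)·|S| < dV·(|V(S)| − 1)`, then with
exponents `e ≡ 2 − dV` every such `S` has positive degree. [cite: King1986, p.664 («every subgraph have positive degree D»)] -/
theorem posSubgraphsBy_GLines_of_sparse (dV : ℝ)
    (h : ∀ S : Finset (Fin m), S.Nonempty → (∀ u ∈ lineVerts src tgt S, ∀ v ∈ lineVerts src tgt S, LConn src tgt S u v) →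
      (dV - 2) * (S.card : ℝ) < dV * (((lineVerts src tgt S).card : ℝ) - 1)) :
    PosSubgraphsBy src tgt 0 dV (fun _ => 2 - dV) := by
  rw [posSubgraphsBy_const_iff]
  intro S hS hc
  have := h S hS hc
  linarith

/-- the triangle is connected to its external vertex `0` (lines `{0,1}`, `{0,2}`). [folklore] -/
theorem lConn_triangle : ∀ v : Fin 3, LConn triSrc triTgt univ 0 v := by
  intro v
  fin_cases v
  · exact Relation.EqvGen.refl _
  · exact Relation.EqvGen.rel _ _ ⟨0, mem_univ _, rfl, rfl⟩
  · exact Relation.EqvGen.rel _ _ ⟨1, mem_univ _, rfl, rfl⟩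

end Sparse

end Summit.QuantumFields.YangMills.BalabanUVNodes.N15KingModelRung.Graph

namespace Summit.QuantumFields.YangMills.BalabanUVNodes.N15KingModelRung.Curved

open scoped BigOperators
open Finset
open Literature.MathematicalPhysics.QuantumFieldTheory.Balaban1983to89.B5Prop11Plancherel (Tor fine unitVec)
open Summit.QuantumFields.YangMills.BalabanUVNodes.N15KingModelRung (KingVolIndex kingVol kingVol_neZero)
open Summit.QuantumFields.YangMills.BalabanUVNodes.N15KingModelRung.Graph

variable {d : ℕ} (L : ℕ) [NeZero L]

/-! ## §2 Proposition 3.6 (3.56) for sparse graphs of `G`-lines — no positivity hypothesis -/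

section Prop36Sparse

omit [NeZero L] in
/-- `G`-lines in `d + 1` dimensions carry the constant exponent `2 − (d+1)`. [cite: King1986, (3.63) p.663] -/
theorem lineExp_GLines_eq (m : ℕ) : (fun _ : Fin m => lineExp (d + 1) (none : Option (Fin (d + 1)))) = fun _ => (2 : ℝ) - ((d + 1 : ℕ) : ℝ) :=
  funext fun _ => lineExp_none

/-- ★★★ **KING 1986 PROPOSITION 3.6 (3.56) FOR SPARSE CONNECTED GRAPHS OF `G`-LINES — NO POSITIVITY HYPOTHESIS — BY NAME AT `A = 0`**: for odd `L ≥ 3`, `a > 0`,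
`m₀² ≥ 0` there are `C₁, C₂, γ₀ > 0` such that for every mass `0 < m² ≤ m₀²`, volume∕scale index `jv`, `n ≥ 1`, every CONNECTED numbered graph all of whose lines
are King's `G`-propagators (`G^η_K` on `T_η`, `G^{η′}_{K+n}` on `T_{η′}`) and all of whose non-empty connected sub-line-sets `S` are SPARSE, `((d+1) − 2)·|S| <
(d+1)·(|V(S)| − 1)`, and abstract one-vertex factors as in part Γ-i:
`|E^{(K+n)}(H) − E^{(K)}(H)| ≤ (Γ′ + Γ·(L^{−γK}·(m+1) + Σ_{υ≠υ₀} s_υ))·C₁^m·C₂^{nn}·(m!·((1 − L^{−¼})^{−1})^m)·Π_{υ≠υ₀} qq_υ`, `γ = min(γ₀, ¼)` — sparsity IS King's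
«every subgraph has positive degree» for `G`-lines (§1), and part Δ-b does the rest. [cite: King1986, Prop. 3.6 (3.56) p.662, p.664, (3.77) p.666, pp.663–665] -/
theorem king_prop36_graph_zeroField_sparse (hLodd : Odd L) (hL : 2 ≤ L) {a : ℝ} (ha : 0 < a) {m0sq : ℝ} (hm0 : 0 ≤ m0sq) :
    ∃ C₁ C₂ γ₀ : ℝ, 0 < C₁ ∧ 0 < C₂ ∧ 0 < γ₀ ∧ ∀ (msq : ℝ), 0 < msq → msq ≤ m0sq → ∀ (jv : KingVolIndex d) (n : ℕ), 1 ≤ n →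
      ∀ (nn m : ℕ) (src tgt : Fin m → Fin (nn + 1)), (∀ v, LConn src tgt univ 0 v) →
      (∀ S : Finset (Fin m), S.Nonempty → (∀ u ∈ lineVerts src tgt S, ∀ v ∈ lineVerts src tgt S, LConn src tgt S u v) →
        (((d + 1 : ℕ) : ℝ) - 2) * (S.card : ℝ) < ((d + 1 : ℕ) : ℝ) * (((lineVerts src tgt S).card : ℝ) - 1)) →
      ∀ (Υ : Type) [Fintype Υ] [DecidableEq Υ]
        (vtx : Υ → Fin (nn + 1)) (υ₀ : Υ), vtx υ₀ = 0 →
        haveI := kingVol_neZero L jv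
        ∀ (u : Υ → Tor (fine (L ^ jv.K) (kingVol L jv)) → ℝ) (u' : Υ → Tor (fine (L ^ (jv.K + n)) (kingVol L jv)) → ℝ)
          (qq s : Υ → ℝ) (p₀ r₀ : Tor (fine (L ^ jv.K) (kingVol L jv)) → ℝ) (Γ Γ' : ℝ),
          (∀ υ, 0 ≤ qq υ) → (∀ υ, 0 ≤ s υ) → (∀ x, 0 ≤ r₀ x) →
          (∀ υ, υ ≠ υ₀ → ∀ x, |u υ x| ≤ qq υ) → (∀ υ, υ ≠ υ₀ → ∀ x', |u' υ x'| ≤ qq υ) →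
          (∀ υ, υ ≠ υ₀ → ∀ x', |u' υ x' - u υ (kingSlicePt L jv.K n (kingVol L jv) x')| ≤ s υ * qq υ) →
          (∀ x, |u υ₀ x| ≤ p₀ x) → (∀ x', |u' υ₀ x'| ≤ p₀ (kingSlicePt L jv.K n (kingVol L jv) x')) →
          (∀ x', |u' υ₀ x' - u υ₀ (kingSlicePt L jv.K n (kingVol L jv) x')| ≤ r₀ (kingSlicePt L jv.K n (kingVol L jv) x')) →
          (∑ x, (((L : ℝ) ^ jv.K)⁻¹) ^ (d + 1) * p₀ x ≤ Γ) → (∑ x, (((L : ℝ) ^ jv.K)⁻¹) ^ (d + 1) * r₀ x ≤ Γ') →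
            |graphValLS ((((L : ℝ) ^ (jv.K + n))⁻¹) ^ (d + 1)) src tgt (fun _ => kingGLine L (kingVol L jv) a msq (jv.K + n) none) vtx u'
                - graphValLS ((((L : ℝ) ^ jv.K)⁻¹) ^ (d + 1)) src tgt (fun _ => kingGLine L (kingVol L jv) a msq jv.K none) vtx u|
              ≤ (Γ' + Γ * ((L : ℝ) ^ (-(min γ₀ (1 / 4) * jv.K)) * (m + 1) + ∑ υ ∈ univ.erase υ₀, s υ))
                * (C₁ ^ m * C₂ ^ nn * ((m.factorial : ℝ) * ((1 - (L : ℝ) ^ (-(1 / 4 : ℝ)))⁻¹) ^ m) * ∏ υ ∈ univ.erase υ₀, qq υ) := by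
  obtain ⟨C₁, C₂, γ₀, hC₁, hC₂, hγ₀, H⟩ := king_prop36_graph_zeroField_subgraphs (d := d) L hLodd hL ha hm0
  refine ⟨C₁, C₂, γ₀, hC₁, hC₂, hγ₀, fun msq hm hcap jv n hn nn m src tgt hconn hsparse Υ _ _ vtx υ₀ hυ₀ u u' qq s p₀ r₀ Γ Γ'
    hqq hs hr₀ hu hu' hus hp₀ hp₀' hr₀' hΓ hΓ' => ?_⟩
  have hP : PosSubgraphsBy src tgt 0 ((d + 1 : ℕ) : ℝ) (fun ℓ => lineExp (d + 1) ((fun _ : Fin m => (none : Option (Fin (d + 1)))) ℓ)) := by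
    rw [show (fun ℓ => lineExp (d + 1) ((fun _ : Fin m => (none : Option (Fin (d + 1)))) ℓ)) = fun _ => (2 : ℝ) - ((d + 1 : ℕ) : ℝ)
      from lineExp_GLines_eq m]
    exact posSubgraphsBy_GLines_of_sparse _ hsparse
  exact H msq hm hcap jv n hn nn m src tgt hconn (fun _ => none) hP Υ vtx υ₀ hυ₀ u u' qq s p₀ r₀ Γ Γ' hqq hs hr₀ hu hu' hus hp₀ hp₀' hr₀' hΓ hΓ'

end Prop36Sparse

/-! ## §3 Connected pseudoforests of `G`-lines in `1 ≤ d ≤ 3` -/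

section Prop36Pseudoforest

/-- ★★★ **KING 1986 PROPOSITION 3.6 (3.56) FOR CONNECTED PSEUDOFORESTS OF `G`-LINES, UNCONDITIONALLY** (`1 ≤ d ≤ 3`): every connected numbered graph of
`G`-lines with no tadpole line, no parallel pair, and `|S| ≤ |V(S)|` for every line set `S` (loops allowed, at most one per component of each sub-line-set) obeys
(3.56) with the constants of `king_prop36_graph_zeroField_sparse` — by part Δ-c `two_le_subDeg_pseudoforest` every sub-line-set has degree `≥ 2`.
[cite: King1986, Prop. 3.6 (3.56) p.662, p.664] -/
theorem king_prop36_graph_zeroField_pseudoforest (hd1 : 1 ≤ d) (hd3 : d ≤ 3) (hLodd : Odd L) (hL : 2 ≤ L) {a : ℝ} (ha : 0 < a)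
    {m0sq : ℝ} (hm0 : 0 ≤ m0sq) :
    ∃ C₁ C₂ γ₀ : ℝ, 0 < C₁ ∧ 0 < C₂ ∧ 0 < γ₀ ∧ ∀ (msq : ℝ), 0 < msq → msq ≤ m0sq → ∀ (jv : KingVolIndex d) (n : ℕ), 1 ≤ n →
      ∀ (nn m : ℕ) (src tgt : Fin m → Fin (nn + 1)), (∀ v, LConn src tgt univ 0 v) →
      (∀ ℓ, src ℓ ≠ tgt ℓ) → (∀ S : Finset (Fin m), S.card ≤ (lineVerts src tgt S).card) →
      (∀ S : Finset (Fin m), S.card = 2 → 3 ≤ (lineVerts src tgt S).card) →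
      ∀ (Υ : Type) [Fintype Υ] [DecidableEq Υ]
        (vtx : Υ → Fin (nn + 1)) (υ₀ : Υ), vtx υ₀ = 0 →
        haveI := kingVol_neZero L jv
        ∀ (u : Υ → Tor (fine (L ^ jv.K) (kingVol L jv)) → ℝ) (u' : Υ → Tor (fine (L ^ (jv.K + n)) (kingVol L jv)) → ℝ)
          (qq s : Υ → ℝ) (p₀ r₀ : Tor (fine (L ^ jv.K) (kingVol L jv)) → ℝ) (Γ Γ' : ℝ),
          (∀ υ, 0 ≤ qq υ) → (∀ υ, 0 ≤ s υ) → (∀ x, 0 ≤ r₀ x) →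
          (∀ υ, υ ≠ υ₀ → ∀ x, |u υ x| ≤ qq υ) → (∀ υ, υ ≠ υ₀ → ∀ x', |u' υ x'| ≤ qq υ) →
          (∀ υ, υ ≠ υ₀ → ∀ x', |u' υ x' - u υ (kingSlicePt L jv.K n (kingVol L jv) x')| ≤ s υ * qq υ) →
          (∀ x, |u υ₀ x| ≤ p₀ x) → (∀ x', |u' υ₀ x'| ≤ p₀ (kingSlicePt L jv.K n (kingVol L jv) x')) →
          (∀ x', |u' υ₀ x' - u υ₀ (kingSlicePt L jv.K n (kingVol L jv) x')| ≤ r₀ (kingSlicePt L jv.K n (kingVol L jv) x')) →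
          (∑ x, (((L : ℝ) ^ jv.K)⁻¹) ^ (d + 1) * p₀ x ≤ Γ) → (∑ x, (((L : ℝ) ^ jv.K)⁻¹) ^ (d + 1) * r₀ x ≤ Γ') →
            |graphValLS ((((L : ℝ) ^ (jv.K + n))⁻¹) ^ (d + 1)) src tgt (fun _ => kingGLine L (kingVol L jv) a msq (jv.K + n) none) vtx u'
                - graphValLS ((((L : ℝ) ^ jv.K)⁻¹) ^ (d + 1)) src tgt (fun _ => kingGLine L (kingVol L jv) a msq jv.K none) vtx u|
              ≤ (Γ' + Γ * ((L : ℝ) ^ (-(min γ₀ (1 / 4) * jv.K)) * (m + 1) + ∑ υ ∈ univ.erase υ₀, s υ))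
                * (C₁ ^ m * C₂ ^ nn * ((m.factorial : ℝ) * ((1 - (L : ℝ) ^ (-(1 / 4 : ℝ)))⁻¹) ^ m) * ∏ υ ∈ univ.erase υ₀, qq υ) := by
  obtain ⟨C₁, C₂, γ₀, hC₁, hC₂, hγ₀, H⟩ := king_prop36_graph_zeroField_sparse (d := d) L hLodd hL ha hm0
  refine ⟨C₁, C₂, γ₀, hC₁, hC₂, hγ₀, fun msq hm hcap jv n hn nn m src tgt hconn h1 h2 h3 Υ _ _ vtx υ₀ hυ₀ u u' qq s p₀ r₀ Γ Γ'
    hqq hs hr₀ hu hu' hus hp₀ hp₀' hr₀' hΓ hΓ' => ?_⟩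
  have hdV : (2 : ℝ) ≤ ((d + 1 : ℕ) : ℝ) := by
    have : (2 : ℕ) ≤ d + 1 := by omega
    exact_mod_cast this
  have hdV' : ((d + 1 : ℕ) : ℝ) ≤ 4 := by
    have : d + 1 ≤ (4 : ℕ) := by omega
    exact_mod_cast this
  -- every non-empty sub-line-set has degree `≥ 2 > 0`: read it as sparsity
  have hsparse : ∀ S : Finset (Fin m), S.Nonempty → (∀ u ∈ lineVerts src tgt S, ∀ v ∈ lineVerts src tgt S, LConn src tgt S u v) →
      (((d + 1 : ℕ) : ℝ) - 2) * (S.card : ℝ) < ((d + 1 : ℕ) : ℝ) * (((lineVerts src tgt S).card : ℝ) - 1) := by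
    intro S hS _
    have h := two_le_subDeg_pseudoforest h1 h2 h3 hdV hdV' hS
    rw [subDeg_const] at h
    linarith
  exact H msq hm hcap jv n hn nn m src tgt hconn hsparse Υ vtx υ₀ hυ₀ u u' qq s p₀ r₀ Γ Γ' hqq hs hr₀ hu hu' hus hp₀ hp₀' hr₀' hΓ hΓ'

end Prop36Pseudoforest

/-! ## §4 The triangle -/

section Prop36Triangle

/-- ★★ **KING 1986 PROPOSITION 3.6 (3.56) FOR THE TRIANGLE, OUTRIGHT** (`1 ≤ d ≤ 3`): the graph `{0,1}, {0,2}, {1,2}` of three `G`-lines on the vertices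
`0, 1, 2` (external vertex `0`) — a graph WITH A LOOP — obeys (3.56) with no hypothesis on degrees: it is a connected pseudoforest without tadpoles or parallel
pairs (part Δ-c, by `decide`). [cite: King1986, Prop. 3.6 (3.56) p.662, p.664] -/
theorem king_prop36_graph_zeroField_triangle (hd1 : 1 ≤ d) (hd3 : d ≤ 3) (hLodd : Odd L) (hL : 2 ≤ L) {a : ℝ} (ha : 0 < a)
    {m0sq : ℝ} (hm0 : 0 ≤ m0sq) :
    ∃ C₁ C₂ γ₀ : ℝ, 0 < C₁ ∧ 0 < C₂ ∧ 0 < γ₀ ∧ ∀ (msq : ℝ), 0 < msq → msq ≤ m0sq → ∀ (jv : KingVolIndex d) (n : ℕ), 1 ≤ n →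
      ∀ (Υ : Type) [Fintype Υ] [DecidableEq Υ]
        (vtx : Υ → Fin (2 + 1)) (υ₀ : Υ), vtx υ₀ = 0 →
        haveI := kingVol_neZero L jv
        ∀ (u : Υ → Tor (fine (L ^ jv.K) (kingVol L jv)) → ℝ) (u' : Υ → Tor (fine (L ^ (jv.K + n)) (kingVol L jv)) → ℝ)
          (qq s : Υ → ℝ) (p₀ r₀ : Tor (fine (L ^ jv.K) (kingVol L jv)) → ℝ) (Γ Γ' : ℝ),
          (∀ υ, 0 ≤ qq υ) → (∀ υ, 0 ≤ s υ) → (∀ x, 0 ≤ r₀ x) →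
          (∀ υ, υ ≠ υ₀ → ∀ x, |u υ x| ≤ qq υ) → (∀ υ, υ ≠ υ₀ → ∀ x', |u' υ x'| ≤ qq υ) →
          (∀ υ, υ ≠ υ₀ → ∀ x', |u' υ x' - u υ (kingSlicePt L jv.K n (kingVol L jv) x')| ≤ s υ * qq υ) →
          (∀ x, |u υ₀ x| ≤ p₀ x) → (∀ x', |u' υ₀ x'| ≤ p₀ (kingSlicePt L jv.K n (kingVol L jv) x')) →
          (∀ x', |u' υ₀ x' - u υ₀ (kingSlicePt L jv.K n (kingVol L jv) x')| ≤ r₀ (kingSlicePt L jv.K n (kingVol L jv) x')) →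
          (∑ x, (((L : ℝ) ^ jv.K)⁻¹) ^ (d + 1) * p₀ x ≤ Γ) → (∑ x, (((L : ℝ) ^ jv.K)⁻¹) ^ (d + 1) * r₀ x ≤ Γ') →
            |graphValLS ((((L : ℝ) ^ (jv.K + n))⁻¹) ^ (d + 1)) triSrc triTgt (fun _ => kingGLine L (kingVol L jv) a msq (jv.K + n) none) vtx u'
                - graphValLS ((((L : ℝ) ^ jv.K)⁻¹) ^ (d + 1)) triSrc triTgt (fun _ => kingGLine L (kingVol L jv) a msq jv.K none) vtx u|
              ≤ (Γ' + Γ * ((L : ℝ) ^ (-(min γ₀ (1 / 4) * jv.K)) * (((3 : ℕ) : ℝ) + 1) + ∑ υ ∈ univ.erase υ₀, s υ))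
                * (C₁ ^ 3 * C₂ ^ 2 * (((Nat.factorial 3 : ℕ) : ℝ) * ((1 - (L : ℝ) ^ (-(1 / 4 : ℝ)))⁻¹) ^ 3) * ∏ υ ∈ univ.erase υ₀, qq υ) := by
  obtain ⟨C₁, C₂, γ₀, hC₁, hC₂, hγ₀, H⟩ := king_prop36_graph_zeroField_pseudoforest (d := d) L hd1 hd3 hLodd hL ha hm0
  refine ⟨C₁, C₂, γ₀, hC₁, hC₂, hγ₀, fun msq hm hcap jv n hn Υ _ _ vtx υ₀ hυ₀ u u' qq s p₀ r₀ Γ Γ'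
    hqq hs hr₀ hu hu' hus hp₀ hp₀' hr₀' hΓ hΓ' => ?_⟩
  exact H msq hm hcap jv n hn 2 3 triSrc triTgt lConn_triangle triangle_noTadpole triangle_pseudoforest triangle_noParallel Υ vtx υ₀ hυ₀
    u u' qq s p₀ r₀ Γ Γ' hqq hs hr₀ hu hu' hus hp₀ hp₀' hr₀' hΓ hΓ'

end Prop36Triangle

end Summit.QuantumFields.YangMills.BalabanUVNodes.N15KingModelRung.Curved

end
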